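import Summits.AtomisticToContinuum.FouriersLaw.Theses.PhononMeanFreePath
import Summits.AtomisticToContinuum.FouriersLaw.Theorems.BoundaryKubo.Negative.LoadBearing
import Summits.AtomisticToContinuum.FouriersLaw.Theorems.PhononMeanFreePathBoundaryKuboUniformLocalMinorizationAux1

/-!
# Uniform local minorisation of the pinned chain at time one (stub `stub_uniformLocalMinorization` of line
`gibbs-ttcf`, crux stmt-AtomisticToContinuum-11812 `PhononMeanFreePath.BoundaryKubo`)

The local minorisation of the transition probabilities of the pinned anharmonic chain at time one near
its equilibrium (`pinnedChain_minorization_at_one`, `LangevinChainLocalMinorization.lean`: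
`P_1(z, T) ≥ c · Leb(T)` for measurable `T ⊆ B(0, r)`, `‖z‖ < ε₁`) with constants `(ε₁, r, c)` UNIFORM
for bath temperatures `(a, b)` in a compact square `[Tlo, Thi]² ⊂ (0, ∞)²`.

The helper file `…UniformLocalMinorizationAux1.lean` re-runs the Hörmander-free submersion proof of the
tree with the temperatures inside the parameter of the submersion lemma
(`uniformLocalMinorization_local`: constants uniform for `(a, b)` in a neighbourhood of any
`(a₀, b₀) ∈ (0,∞)²`); here the compact square is covered by finitely many such neighbourhoods
(`IsCompact.elim_nhds_subcover`) and the minimum of the finitely many constants is taken.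
-/

noncomputable section

open scoped NNReal ENNReal Topology
open MeasureTheory Filter Set

namespace Summit.AtomisticToContinuum.FouriersLaw.Theorems.BoundaryKubo.GibbsTtcf

open Literature.MathematicalPhysics.KineticTheory.HeatConduction
open Metric

/-- **Local minorisation of the pinned chain at time one, near the equilibrium, uniformly for bath
temperatures in a compact range**: for `0 < Tlo ≤ Thi` there are `ε₁, r > 0` and `c > 0` such that
`P^{a,b}_1(z, S) ≥ c · Leb(S)` for every measurable `S ⊆ B(0, r)`, every `‖z‖ < ε₁` and all
`a, b ∈ [Tlo, Thi]` (finite subcover of the square by the neighbourhoods of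
`uniformLocalMinorization_local`). [cite: CuneoEckmannHairerReyBellet2018, Prop 3.6 (proof)] -/
theorem stub_uniformLocalMinorization :
    ∀ ω₂ lam β γ : ℝ, 0 < ω₂ → 0 < lam → 0 < β → 0 < γ → ∀ (N : ℕ) (Tlo Thi : ℝ), 0 < Tlo → Tlo ≤ Thi →
      ∃ ε₁ : ℝ, 0 < ε₁ ∧ ∃ r : ℝ, 0 < r ∧ ∃ c : ℝ≥0∞, 0 < c ∧
        ∀ a b : ℝ, Tlo ≤ a → a ≤ Thi → Tlo ≤ b → b ≤ Thi →
          ∀ z : PhaseSpace (N + 1), ‖z‖ < ε₁ →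
            ∀ S ⊆ Metric.ball (0 : PhaseSpace (N + 1)) r, MeasurableSet S →
              c * volume S ≤ (pinnedChain ω₂ lam β γ).transitionKernel (N + 1) a b 1 z S := by
  intro ω₂ lam β γ hω hl hβ hγ N Tlo Thi hTlo hTT
  classical
  -- the compact square of temperatures
  set Q : Set (ℝ × ℝ) := Icc Tlo Thi ×ˢ Icc Tlo Thi with hQ
  have hQc : IsCompact Q := isCompact_Icc.prod isCompact_Icc
  -- local data at every point (junk values off the open quadrant)
  have hchoice : ∀ q : ℝ × ℝ, ∃ ε₁ : ℝ, 0 < ε₁ ∧ ∃ r : ℝ, 0 < r ∧ ∃ c : ℝ≥0∞, 0 < c ∧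
      (0 < q.1 → 0 < q.2 → ∀ a b : ℝ, |a - q.1| < ε₁ → |b - q.2| < ε₁ →
        ∀ z : PhaseSpace (N + 1), ‖z‖ < ε₁ →
          ∀ S ⊆ Metric.ball (0 : PhaseSpace (N + 1)) r, MeasurableSet S →
            c * volume S ≤ (pinnedChain ω₂ lam β γ).transitionKernel (N + 1) a b 1 z S) := by
    intro q
    by_cases h : 0 < q.1 ∧ 0 < q.2
    · obtain ⟨ε₁, hε₁, r, hr, c, hc, h'⟩ :=
        uniformLocalMinorization_local ω₂ lam β γ hω hl hβ hγ N q.1 q.2 h.1 h.2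
      exact ⟨ε₁, hε₁, r, hr, c, hc, fun _ _ => h'⟩
    · exact ⟨1, one_pos, 1, one_pos, 1, one_pos, fun h1 h2 => absurd ⟨h1, h2⟩ h⟩
  choose εf hεf rf hrf cf hcf hP using hchoice
  -- a finite subcover of the square by the balls `B(q, εf q)`
  obtain ⟨t, htQ, hcover⟩ := hQc.elim_nhds_subcover (fun q => ball q (εf q))
    (fun q _ => ball_mem_nhds q (hεf q))
  have htne : t.Nonempty := by
    have hmem : ((Tlo, Tlo) : ℝ × ℝ) ∈ Q := ⟨⟨le_rfl, hTT⟩, ⟨le_rfl, hTT⟩⟩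
    obtain ⟨q, hq, _⟩ := mem_iUnion₂.1 (hcover hmem)
    exact ⟨q, hq⟩
  refine ⟨t.inf' htne εf, (Finset.lt_inf'_iff htne).2 fun q _ => hεf q, t.inf' htne rf,
    (Finset.lt_inf'_iff htne).2 fun q _ => hrf q, t.inf' htne cf,
    (Finset.lt_inf'_iff htne).2 fun q _ => hcf q, fun a b ha1 ha2 hb1 hb2 z hz S hS hSm => ?_⟩
  -- the temperatures lie in one of the balls
  have hab : ((a, b) : ℝ × ℝ) ∈ Q := ⟨⟨ha1, ha2⟩, ⟨hb1, hb2⟩⟩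
  obtain ⟨q, hq, hqball⟩ := mem_iUnion₂.1 (hcover hab)
  have hqQ : q ∈ Q := htQ q hq
  have hq1 : 0 < q.1 := hTlo.trans_le hqQ.1.1
  have hq2 : 0 < q.2 := hTlo.trans_le hqQ.2.1
  have hdist : |a - q.1| < εf q ∧ |b - q.2| < εf q := by
    have h1 : dist ((a, b) : ℝ × ℝ) q < εf q := mem_ball.1 hqball
    have h2 : dist ((a, b) : ℝ × ℝ) q = max (dist a q.1) (dist b q.2) := Prod.dist_eq
    rw [h2, max_lt_iff, Real.dist_eq, Real.dist_eq] at h1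
    exact h1
  have hε : t.inf' htne εf ≤ εf q := Finset.inf'_le _ hq
  have hr : t.inf' htne rf ≤ rf q := Finset.inf'_le _ hq
  have hc : t.inf' htne cf ≤ cf q := Finset.inf'_le _ hq
  calc t.inf' htne cf * volume S ≤ cf q * volume S := mul_le_mul' hc le_rfl
    _ ≤ (pinnedChain ω₂ lam β γ).transitionKernel (N + 1) a b 1 z S :=
        hP q hq1 hq2 a b hdist.1 hdist.2 z (hz.trans_le hε) S (hS.trans (ball_subset_ball hr)) hSm

end Summit.AtomisticToContinuum.FouriersLaw.Theorems.BoundaryKubo.GibbsTtcf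

end
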